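import Summits.CriticalPhenomena.PercolationContinuityZ3.Theorems.PercNearOneGluingNoHeavyLowerTailTIncBernsteinFibreCert
import Summits.CriticalPhenomena.PercolationContinuityZ3.Theorems.PercNearOneGluingNoHeavyLowerTailCubicThreePointTincInduction
import Mathlib.Tactic.Linarith
import HarnessLib

/-!
# `NoHeavyLowerTail` (stmt-CriticalPhenomena-4575) — (TB1),(TB2) by fibrewise positivity of the `T_inc` certificate, III:
# the clean gluing-pencil forms and the tree's `threeTB₁`, `threeTB₂`

Support file (prover prim-l12-p6 gen 3; `--supports stmt-CriticalPhenomena-4575`).  No named facts, no sorries, no definitions.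
* `threeTB₁_eq_polar`, `threeTB₂_eq_polar` (`ring`): the (2,1)/(1,2) polarisations `P12(c⁰; c⁰+δ)`, `P21(c⁰; c⁰+δ)` of `T_inc` ARE
  `CubicThreePointStep.threeTB₁/threeTB₂ (c⁰, δ)` of `…CubicThreePointTincInduction` (`δ` = the five apex transition masses).
* `tincPolar12_nonneg`, `tincPolar21_nonneg`: for every finite weighted graph (`PrW D p`, `p ∈ [0,1]`), every pair `e ∉ D` and all `a b c`:
  `0 ≤ P12(c⁰; c¹)` and `0 ≤ P21(c⁰; c¹)`, `c⁰` = the five three-point cells of the law, `c¹` = those of the law of `S ↦ S ∪ {e}` (the pair glued):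
  the two middle Bernstein coefficients of `T_inc` along the pencil `law(G) → law(G/e)` are nonnegative — for EVERY pair, apex or not
  (from part II at `insert e D` with weight `½` on `e`).
* `threeTB₁_nonneg_of_transitions`, `threeTB₂_nonneg_of_transitions`: **(TB1), (TB2)** in the tree's vocabulary — `0 ≤ threeTB₁`, `0 ≤ threeTB₂`
  at the cells of `PrW D p` and any reals `α₁, α₂, β₁, β₂, β₃` through which the glued cells decompose
  (`q¹ = q−α₁−α₂`, `u_c¹ = u_c+α₁−β₁`, `u_b¹ = u_b+α₂−β₂`, `u_a¹ = u_a−β₃`, `t¹ = t+β₁+β₂+β₃`; for an apex pair `e ∋ a` these are the transition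
  masses `μ(a|by|c), μ(a|b|cy), μ(ab|cy), μ(ac|by), μ(a|bcy)` of `bernsteinCells`/`StepHypT`).
So `StepHypT`-type hypotheses (ttrl census l.640: 0/230 M violations) are theorems; `T_inc ≥ 0` itself was already `TIncSwitching.tIncRow_holds` —
the content here is the pair of NEW four-point cubic inequalities (TB1),(TB2), which have no multiplier certificate over the α-free proved
four-point dictionary (prim-l12-p6 g3, FROM-prim-l12-p6-g3-TINC-BERNSTEIN.md).  [this work]
-/

noncomputable section

namespace Summit.CriticalPhenomena.PercolationContinuityZ3.Theorems

namespace TIncFibre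

open Finset Literature.Probability.Percolation Literature.Probability.Percolation.DecisionTree
open Literature.Probability.Percolation.Gladkov ThreePointLB TIncSwitching
open Literature.Probability.Percolation.DecisionTree.DTree2 (ins wt1 mem_ins_self_iff)
open scoped Classical

variable {V : Type*} [Fintype V] [DecidableEq V]
/-! ### The polarisation forms are the tree's `threeTB₁`, `threeTB₂` at an apex pair -/

section Algebra

variable {R : Type*} [CommRing R]

/-- `P12(c⁰; c⁰ + δ) = threeTB₁(c⁰, δ)` for the five apex transition masses `δ` (`ring`). [folklore] -/
theorem threeTB₁_eq_polar (q u₁ u₂ u₃ t α₁ α₂ β₁ β₂ β₃ : R) :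
    CubicThreePointStep.threeTB₁ q u₁ u₂ u₃ t α₁ α₂ β₁ β₂ β₃ =
      (fun (q₀ ua₀ ub₀ uc₀ t₀ q₁ ua₁ ub₁ uc₁ t₁ : R) => 2 * q₀ ^ 2 * t₁ - 2 * q₀ * ua₀ * ub₁ - 2 * q₀ * ua₀ * uc₁ - 2 * q₀ * ub₀ * uc₁ + q₀ * t₀ * ua₁ + q₀ * t₀ * ub₁ + q₀ * t₀ * uc₁ + 2 * q₀ * t₀ * t₁ + 4 * q₀ * t₀ * q₁ - 2 * q₀ * ub₀ * ua₁ - 2 * q₀ * uc₀ * ua₁ - 2 * q₀ * uc₀ * ub₁ + q₀ * ua₀ * t₁ + q₀ * ub₀ * t₁ + q₀ * uc₀ * t₁ - ua₀ ^ 2 * ub₁ - ua₀ ^ 2 * uc₁ - 2 * ua₀ * ub₀ * ub₁ - 4 * ua₀ * ub₀ * uc₁ - 2 * ua₀ * uc₀ * uc₁ - 2 * ua₀ * ub₀ * ua₁ - 2 * ua₀ * uc₀ * ua₁ - 4 * ua₀ * uc₀ * ub₁ - ub₀ ^ 2 * uc₁ - 2 * ub₀ * uc₀ * uc₁ - 2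 * ub₀ * uc₀ * ub₁ - ua₀ * t₀ * ub₁ - ua₀ * t₀ * uc₁ - ub₀ * t₀ * uc₁ - ub₀ * t₀ * ua₁ - uc₀ * t₀ * ua₁ - uc₀ * t₀ * ub₁ - 2 * ua₀ * ub₀ * q₁ - 2 * ua₀ * uc₀ * q₁ - 2 * ub₀ * uc₀ * q₁ + t₀ ^ 2 * q₁ + ua₀ * t₀ * q₁ + ub₀ * t₀ * q₁ + uc₀ * t₀ * q₁ - ub₀ ^ 2 * ua₁ - 4 * ub₀ * uc₀ * ua₁ - uc₀ ^ 2 * ua₁ - uc₀ ^ 2 * ub₁ - ua₀ * ub₀ * t₁ - ua₀ * uc₀ * t₁ - ub₀ * uc₀ * t₁)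
        q u₃ u₂ u₁ t (q - α₁ - α₂) (u₃ - β₃) (u₂ + α₂ - β₂) (u₁ + α₁ - β₁) (t + β₁ + β₂ + β₃) := by
  simp only [CubicThreePointStep.threeTB₁]
  ring

/-- `P21(c⁰; c⁰ + δ) = threeTB₂(c⁰, δ)` (`ring`). [folklore] -/
theorem threeTB₂_eq_polar (q u₁ u₂ u₃ t α₁ α₂ β₁ β₂ β₃ : R) :
    CubicThreePointStep.threeTB₂ q u₁ u₂ u₃ t α₁ α₂ β₁ β₂ β₃ =
      (fun (q₀ ua₀ ub₀ uc₀ t₀ q₁ ua₁ ub₁ uc₁ t₁ : R) => 4 * q₀ * q₁ * t₁ - 2 * q₀ * ua₁ * ub₁ - 2 * q₀ * ua₁ * uc₁ - 2 * q₀ * ub₁ * uc₁ + q₀ * t₁ ^ 2 + q₀ * ua₁ * t₁ + q₀ * ub₁ * t₁ + q₀ * uc₁ * t₁ - 2 * ua₀ * ua₁ * ub₁ - 2 * ua₀ * ua₁ * uc₁ - ua₀ * ub₁ ^ 2 - 4 * ua₀ * ub₁ * uc₁ - ua₀ * uc₁ ^ 2 - 2 * ub₀ * ub₁ * uc₁ -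 ub₀ * uc₁ ^ 2 - t₀ * ua₁ * ub₁ - t₀ * ua₁ * uc₁ - t₀ * ub₁ * uc₁ + 2 * t₀ * q₁ ^ 2 - 2 * ua₀ * q₁ * ub₁ - 2 * ua₀ * q₁ * uc₁ - 2 * ub₀ * q₁ * uc₁ + t₀ * q₁ * ua₁ + t₀ * q₁ * ub₁ + t₀ * q₁ * uc₁ + 2 * t₀ * q₁ * t₁ - 2 * ub₀ * q₁ * ua₁ - 2 * uc₀ * q₁ * ua₁ - 2 * uc₀ * q₁ * ub₁ + ua₀ * q₁ * t₁ + ub₀ * q₁ * t₁ + uc₀ * q₁ * t₁ - ub₀ * ua₁ ^ 2 - uc₀ * ua₁ ^ 2 - 2 * ub₀ * ua₁ * ub₁ - 4 * ub₀ * ua₁ * uc₁ - 2 * uc₀ * ua₁ * uc₁ - 4 * uc₀ * ua₁ * ub₁ - uc₀ * ub₁ ^ 2 - 2 * uc₀ * ub₁ * uc₁ - ua₀ * ub₁ * t₁ - ua₀ * uc₁ * t₁ - ub₀ * uc₁ * t₁ - ub₀ * ua₁ * t₁ - uc₀ * ua₁ * t₁ - uc₀ * ub₁ * t₁)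
        q u₃ u₂ u₁ t (q - α₁ - α₂) (u₃ - β₃) (u₂ + α₂ - β₂) (u₁ + α₁ - β₁) (t + β₁ + β₂ + β₃) := by
  simp only [CubicThreePointStep.threeTB₂]
  ring

end Algebra

/-! ### Clean forms: the gluing pencil of an extra pair `e ∉ D` -/

section Pencil

variable {p : Sym2 V → ℝ} (hp0 : ∀ i, 0 ≤ p i) (hp1 : ∀ i, p i ≤ 1) (D : Finset (Sym2 V)) (a b c : V) {e : Sym2 V}

omit [Fintype V] in
/-- `PrW` only depends on the weights on `D` (local copy of `PrW_congr_weights`). [folklore] -/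
private theorem PrW_congr_weights' (D : Finset (Sym2 V)) {p p' : Sym2 V → ℝ} (h : ∀ i ∈ D, p' i = p i)
    (X : Set (Finset (Sym2 V))) : PrW D p' X = PrW D p X := by
  unfold PrW
  refine Finset.sum_congr rfl fun S _ => ?_
  have hw : wtW D p' S = wtW D p S := by
    unfold wtW
    exact Finset.prod_congr rfl fun i hi => by rw [h i hi]
  simp only [Set.indicator, hw]

include hp0 hp1

/-- **(TB1) for every gluing pencil.**  Let `c⁰` be the five three-point cells `q = μ(a|b|c)`, `u_a = μ(bc|a)`, `u_b = μ(ac|b)`, `u_c = μ(ab|c)`,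
`t = μ(abc)` of the law `PrW D p`, and `c¹` the same cells of the law of `S ↦ S ∪ {e}` (the pair `e ∉ D` glued / forced open).  Then the
(2,1)-polarisation of `T_inc` is nonnegative: `0 ≤ P12(c⁰; c¹)` — i.e. the first Bernstein coefficient of `T_inc` along the pencil from
`law(G)` to `law(G/e)` is `≥ 0`, for EVERY pair `e` (apex or not) of EVERY finite weighted graph. [this work] -/
theorem tincPolar12_nonneg (he : e ∉ D) :
    0 ≤ 2 * (PrW D p ((conn a b)ᶜ ∩ ((conn a c)ᶜ ∩ (conn b c)ᶜ))) ^ 2 * (PrW D p {S | insert e S ∈ (conn a b ∩ conn a c)}) - 2 * (PrW D p ((conn a b)ᶜ ∩ ((conn a c)ᶜ ∩ (conn b c)ᶜ))) * (PrW D p (conn b c ∩ (conn a b)ᶜ)) * (PrW D p {S | insert e S ∈ (conn a c ∩ (conn a b)ᶜ)}) - 2 * (PrW D p ((conn a b)ᶜ ∩ ((conn a c)ᶜ ∩ (conn b c)ᶜ))) * (PrW D p (conn b c ∩ (conn a b)ᶜ)) * (PrW D p {S | insert e S ∈ (conn a b ∩ (conn a c)ᶜ)}) - 2 * (PrW D p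 ((conn a b)ᶜ ∩ ((conn a c)ᶜ ∩ (conn b c)ᶜ))) * (PrW D p (conn a c ∩ (conn a b)ᶜ)) * (PrW D p {S | insert e S ∈ (conn a b ∩ (conn a c)ᶜ)}) + (PrW D p ((conn a b)ᶜ ∩ ((conn a c)ᶜ ∩ (conn b c)ᶜ))) * (PrW D p (conn a b ∩ conn a c)) * (PrW D p {S | insert e S ∈ (conn b c ∩ (conn a b)ᶜ)}) + (PrW D p ((conn a b)ᶜ ∩ ((conn a c)ᶜ ∩ (conn b c)ᶜ))) * (PrW D p (conn a b ∩ conn a c)) * (PrW D p {S | insert e S ∈ (conn a c ∩ (conn a b)ᶜ)}) + (PrW D p ((conn a b)ᶜ ∩ ((conn a c)ᶜ ∩ (conn b c)ᶜ))) * (PrW D p (conn a b ∩ conn a c)) * (PrW D p {S | insert e S ∈ (conn a b ∩ (conn a c)ᶜ)}) + 2 * (PrW D p ((conn a b)ᶜ ∩ ((conn a c)ᶜ ∩ (conn b c)ᶜ))) * (PrW D p (conn a b ∩ conn a c)) * (PrW D p {S | insert e S ∈ (conn a b ∩ conn a c)}) + 4 * (PrW D p ((conn a b)ᶜ ∩ ((conn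 a c)ᶜ ∩ (conn b c)ᶜ))) * (PrW D p (conn a b ∩ conn a c)) * (PrW D p {S | insert e S ∈ ((conn a b)ᶜ ∩ ((conn a c)ᶜ ∩ (conn b c)ᶜ))}) - 2 * (PrW D p ((conn a b)ᶜ ∩ ((conn a c)ᶜ ∩ (conn b c)ᶜ))) * (PrW D p (conn a c ∩ (conn a b)ᶜ)) * (PrW D p {S | insert e S ∈ (conn b c ∩ (conn a b)ᶜ)}) - 2 * (PrW D p ((conn a b)ᶜ ∩ ((conn a c)ᶜ ∩ (conn b c)ᶜ))) * (PrW D p (conn a b ∩ (conn a c)ᶜ)) * (PrW D p {S | insert e S ∈ (conn b c ∩ (conn a b)ᶜ)}) - 2 * (PrW D p ((conn a b)ᶜ ∩ ((conn a c)ᶜ ∩ (conn b c)ᶜ))) * (PrW D p (conn a b ∩ (conn a c)ᶜ)) * (PrW D p {S | insert e S ∈ (conn a c ∩ (conn a b)ᶜ)}) + (PrW D p ((conn a b)ᶜ ∩ ((conn a c)ᶜ ∩ (conn b c)ᶜ))) * (PrW D p (conn b c ∩ (conn a b)ᶜ)) * (PrW D p {S | insert e S ∈ (conn a b ∩ conn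 a c)}) + (PrW D p ((conn a b)ᶜ ∩ ((conn a c)ᶜ ∩ (conn b c)ᶜ))) * (PrW D p (conn a c ∩ (conn a b)ᶜ)) * (PrW D p {S | insert e S ∈ (conn a b ∩ conn a c)}) + (PrW D p ((conn a b)ᶜ ∩ ((conn a c)ᶜ ∩ (conn b c)ᶜ))) * (PrW D p (conn a b ∩ (conn a c)ᶜ)) * (PrW D p {S | insert e S ∈ (conn a b ∩ conn a c)}) - (PrW D p (conn b c ∩ (conn a b)ᶜ)) ^ 2 * (PrW D p {S | insert e S ∈ (conn a c ∩ (conn a b)ᶜ)}) - (PrW D p (conn b c ∩ (conn a b)ᶜ)) ^ 2 * (PrW D p {S | insert e S ∈ (conn a b ∩ (conn a c)ᶜ)}) - 2 * (PrW D p (conn b c ∩ (conn a b)ᶜ)) * (PrW D p (conn a c ∩ (conn a b)ᶜ)) * (PrW D p {S | insert e S ∈ (conn a c ∩ (conn a b)ᶜ)}) - 4 * (PrW D p (conn b c ∩ (conn a b)ᶜ)) * (PrW D p (conn a c ∩ (conn a b)ᶜ)) * (PrW D p {S | insert e S ∈ (conn a b ∩ (conn a c)ᶜ)}) - 2 * (PrW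 D p (conn b c ∩ (conn a b)ᶜ)) * (PrW D p (conn a b ∩ (conn a c)ᶜ)) * (PrW D p {S | insert e S ∈ (conn a b ∩ (conn a c)ᶜ)}) - 2 * (PrW D p (conn b c ∩ (conn a b)ᶜ)) * (PrW D p (conn a c ∩ (conn a b)ᶜ)) * (PrW D p {S | insert e S ∈ (conn b c ∩ (conn a b)ᶜ)}) - 2 * (PrW D p (conn b c ∩ (conn a b)ᶜ)) * (PrW D p (conn a b ∩ (conn a c)ᶜ)) * (PrW D p {S | insert e S ∈ (conn b c ∩ (conn a b)ᶜ)}) - 4 * (PrW D p (conn b c ∩ (conn a b)ᶜ)) * (PrW D p (conn a b ∩ (conn a c)ᶜ)) * (PrW D p {S | insert e S ∈ (conn a c ∩ (conn a b)ᶜ)}) - (PrW D p (conn a c ∩ (conn a b)ᶜ)) ^ 2 * (PrW D p {S | insert e S ∈ (conn a b ∩ (conn a c)ᶜ)}) - 2 * (PrW D p (conn a c ∩ (conn a b)ᶜ)) * (PrW D p (conn a b ∩ (conn a c)ᶜ)) * (PrW D p {S | insert e S ∈ (conn a b ∩ (conn a c)ᶜ)}) - 2 * (PrW D p (conn a c ∩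 (conn a b)ᶜ)) * (PrW D p (conn a b ∩ (conn a c)ᶜ)) * (PrW D p {S | insert e S ∈ (conn a c ∩ (conn a b)ᶜ)}) - (PrW D p (conn b c ∩ (conn a b)ᶜ)) * (PrW D p (conn a b ∩ conn a c)) * (PrW D p {S | insert e S ∈ (conn a c ∩ (conn a b)ᶜ)}) - (PrW D p (conn b c ∩ (conn a b)ᶜ)) * (PrW D p (conn a b ∩ conn a c)) * (PrW D p {S | insert e S ∈ (conn a b ∩ (conn a c)ᶜ)}) - (PrW D p (conn a c ∩ (conn a b)ᶜ)) * (PrW D p (conn a b ∩ conn a c)) * (PrW D p {S | insert e S ∈ (conn a b ∩ (conn a c)ᶜ)}) - (PrW D p (conn a c ∩ (conn a b)ᶜ)) * (PrW D p (conn a b ∩ conn a c)) * (PrW D p {S | insert e S ∈ (conn b c ∩ (conn a b)ᶜ)}) - (PrW D p (conn a b ∩ (conn a c)ᶜ)) * (PrW D p (conn a b ∩ conn a c)) * (PrW D p {S | insert e S ∈ (conn b c ∩ (conn a b)ᶜ)}) - (PrW D p (conn a b ∩ (conn a c)ᶜ)) * (PrW D p (conn a b ∩ conn a c)) * (PrW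 D p {S | insert e S ∈ (conn a c ∩ (conn a b)ᶜ)}) - 2 * (PrW D p (conn b c ∩ (conn a b)ᶜ)) * (PrW D p (conn a c ∩ (conn a b)ᶜ)) * (PrW D p {S | insert e S ∈ ((conn a b)ᶜ ∩ ((conn a c)ᶜ ∩ (conn b c)ᶜ))}) - 2 * (PrW D p (conn b c ∩ (conn a b)ᶜ)) * (PrW D p (conn a b ∩ (conn a c)ᶜ)) * (PrW D p {S | insert e S ∈ ((conn a b)ᶜ ∩ ((conn a c)ᶜ ∩ (conn b c)ᶜ))}) - 2 * (PrW D p (conn a c ∩ (conn a b)ᶜ)) * (PrW D p (conn a b ∩ (conn a c)ᶜ)) * (PrW D p {S | insert e S ∈ ((conn a b)ᶜ ∩ ((conn a c)ᶜ ∩ (conn b c)ᶜ))}) + (PrW D p (conn a b ∩ conn a c)) ^ 2 * (PrW D p {S | insert e S ∈ ((conn a b)ᶜ ∩ ((conn a c)ᶜ ∩ (conn b c)ᶜ))}) + (PrW D p (conn b c ∩ (conn a b)ᶜ)) * (PrW D p (conn a b ∩ conn a c)) * (PrW D p {S | insert e S ∈ ((conn a b)ᶜ ∩ ((conn a c)ᶜ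 ∩ (conn b c)ᶜ))}) + (PrW D p (conn a c ∩ (conn a b)ᶜ)) * (PrW D p (conn a b ∩ conn a c)) * (PrW D p {S | insert e S ∈ ((conn a b)ᶜ ∩ ((conn a c)ᶜ ∩ (conn b c)ᶜ))}) + (PrW D p (conn a b ∩ (conn a c)ᶜ)) * (PrW D p (conn a b ∩ conn a c)) * (PrW D p {S | insert e S ∈ ((conn a b)ᶜ ∩ ((conn a c)ᶜ ∩ (conn b c)ᶜ))}) - (PrW D p (conn a c ∩ (conn a b)ᶜ)) ^ 2 * (PrW D p {S | insert e S ∈ (conn b c ∩ (conn a b)ᶜ)}) - 4 * (PrW D p (conn a c ∩ (conn a b)ᶜ)) * (PrW D p (conn a b ∩ (conn a c)ᶜ)) * (PrW D p {S | insert e S ∈ (conn b c ∩ (conn a b)ᶜ)}) - (PrW D p (conn a b ∩ (conn a c)ᶜ)) ^ 2 * (PrW D p {S | insert e S ∈ (conn b c ∩ (conn a b)ᶜ)}) - (PrW D p (conn a b ∩ (conn a c)ᶜ)) ^ 2 * (PrW D p {S | insert e S ∈ (conn a c ∩ (conn a b)ᶜ)}) - (PrW D p (conn b c ∩ (conn a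 b)ᶜ)) * (PrW D p (conn a c ∩ (conn a b)ᶜ)) * (PrW D p {S | insert e S ∈ (conn a b ∩ conn a c)}) - (PrW D p (conn b c ∩ (conn a b)ᶜ)) * (PrW D p (conn a b ∩ (conn a c)ᶜ)) * (PrW D p {S | insert e S ∈ (conn a b ∩ conn a c)}) - (PrW D p (conn a c ∩ (conn a b)ᶜ)) * (PrW D p (conn a b ∩ (conn a c)ᶜ)) * (PrW D p {S | insert e S ∈ (conn a b ∩ conn a c)}) := by
  have hp0' : ∀ i, 0 ≤ Function.update p e (1 / 2 : ℝ) i := by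
    intro i
    by_cases hi : i = e
    · rw [hi, Function.update_self]; norm_num
    · rw [Function.update_of_ne hi]; exact hp0 i
  have hp1' : ∀ i, Function.update p e (1 / 2 : ℝ) i ≤ 1 := by
    intro i
    by_cases hi : i = e
    · rw [hi, Function.update_self]; norm_num
    · rw [Function.update_of_ne hi]; exact hp1 i
  have key := polar_one_nonneg hp0' hp1' (insert e D) a b c (Finset.mem_insert_self e D)
  rw [Finset.erase_insert he, Function.update_self] at key
  have hW : ∀ X : Set (Finset (Sym2 V)), PrW D (Function.update p e (1 / 2 : ℝ)) X = PrW D p X :=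
    fun X => PrW_congr_weights' D (fun i hi => Function.update_of_ne (ne_of_mem_of_not_mem hi he) _ _) X
  have h0 : ∀ E : Set (Finset (Sym2 V)), {S | ins e false S ∈ E} = E := fun E => by
    ext S; simp [ins]
  have h1 : ∀ E : Set (Finset (Sym2 V)), {S | ins e true S ∈ E} = {S | insert e S ∈ E} := fun E => by
    ext S; simp [ins]
  simp only [hW, h0, h1] at key
  exact nonneg_of_mul_nonneg_right key (by norm_num)

/-- **(TB2) for every gluing pencil**: the (1,2)-polarisation `P21(c⁰; c¹)` of `T_inc` is nonnegative. [this work] -/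
theorem tincPolar21_nonneg (he : e ∉ D) :
    0 ≤ 4 * (PrW D p ((conn a b)ᶜ ∩ ((conn a c)ᶜ ∩ (conn b c)ᶜ))) * (PrW D p {S | insert e S ∈ ((conn a b)ᶜ ∩ ((conn a c)ᶜ ∩ (conn b c)ᶜ))}) * (PrW D p {S | insert e S ∈ (conn a b ∩ conn a c)}) - 2 * (PrW D p ((conn a b)ᶜ ∩ ((conn a c)ᶜ ∩ (conn b c)ᶜ))) * (PrW D p {S | insert e S ∈ (conn b c ∩ (conn a b)ᶜ)}) * (PrW D p {S | insert e S ∈ (conn a c ∩ (conn a b)ᶜ)}) - 2 * (PrW D p ((conn a b)ᶜ ∩ ((conn a c)ᶜ ∩ (conn b c)ᶜ))) * (PrW D p {S | insert e S ∈ (conn b c ∩ (conn a b)ᶜ)}) * (PrW D p {S | insert e S ∈ (conn a b ∩ (conn a c)ᶜ)}) - 2 * (PrW D p ((conn a b)ᶜ ∩ ((conn a c)ᶜ ∩ (conn b c)ᶜ))) * (PrW D p {S | insert e S ∈ (conn a c ∩ (conn a b)ᶜ)}) * (PrW D p {S | insert e S ∈ (conn a b ∩ (conn a c)ᶜ)})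 + (PrW D p ((conn a b)ᶜ ∩ ((conn a c)ᶜ ∩ (conn b c)ᶜ))) * (PrW D p {S | insert e S ∈ (conn a b ∩ conn a c)}) ^ 2 + (PrW D p ((conn a b)ᶜ ∩ ((conn a c)ᶜ ∩ (conn b c)ᶜ))) * (PrW D p {S | insert e S ∈ (conn b c ∩ (conn a b)ᶜ)}) * (PrW D p {S | insert e S ∈ (conn a b ∩ conn a c)}) + (PrW D p ((conn a b)ᶜ ∩ ((conn a c)ᶜ ∩ (conn b c)ᶜ))) * (PrW D p {S | insert e S ∈ (conn a c ∩ (conn a b)ᶜ)}) * (PrW D p {S | insert e S ∈ (conn a b ∩ conn a c)}) + (PrW D p ((conn a b)ᶜ ∩ ((conn a c)ᶜ ∩ (conn b c)ᶜ))) * (PrW D p {S | insert e S ∈ (conn a b ∩ (conn a c)ᶜ)}) * (PrW D p {S | insert e S ∈ (conn a b ∩ conn a c)}) - 2 * (PrW D p (conn b c ∩ (conn a b)ᶜ)) * (PrW D p {S | insert e S ∈ (conn b c ∩ (conn a b)ᶜ)}) * (PrW D p {S | insert e S ∈ (conn a c ∩ (conn a b)ᶜ)}) - 2 * (PrW D p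 (conn b c ∩ (conn a b)ᶜ)) * (PrW D p {S | insert e S ∈ (conn b c ∩ (conn a b)ᶜ)}) * (PrW D p {S | insert e S ∈ (conn a b ∩ (conn a c)ᶜ)}) - (PrW D p (conn b c ∩ (conn a b)ᶜ)) * (PrW D p {S | insert e S ∈ (conn a c ∩ (conn a b)ᶜ)}) ^ 2 - 4 * (PrW D p (conn b c ∩ (conn a b)ᶜ)) * (PrW D p {S | insert e S ∈ (conn a c ∩ (conn a b)ᶜ)}) * (PrW D p {S | insert e S ∈ (conn a b ∩ (conn a c)ᶜ)}) - (PrW D p (conn b c ∩ (conn a b)ᶜ)) * (PrW D p {S | insert e S ∈ (conn a b ∩ (conn a c)ᶜ)}) ^ 2 - 2 * (PrW D p (conn a c ∩ (conn a b)ᶜ)) * (PrW D p {S | insert e S ∈ (conn a c ∩ (conn a b)ᶜ)}) * (PrW D p {S | insert e S ∈ (conn a b ∩ (conn a c)ᶜ)}) - (PrW D p (conn a c ∩ (conn a b)ᶜ)) * (PrW D p {S | insert e S ∈ (conn a b ∩ (conn a c)ᶜ)}) ^ 2 - (PrW D p (conn a b ∩ conn a c)) * (PrW D p {S | insert e S ∈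 (conn b c ∩ (conn a b)ᶜ)}) * (PrW D p {S | insert e S ∈ (conn a c ∩ (conn a b)ᶜ)}) - (PrW D p (conn a b ∩ conn a c)) * (PrW D p {S | insert e S ∈ (conn b c ∩ (conn a b)ᶜ)}) * (PrW D p {S | insert e S ∈ (conn a b ∩ (conn a c)ᶜ)}) - (PrW D p (conn a b ∩ conn a c)) * (PrW D p {S | insert e S ∈ (conn a c ∩ (conn a b)ᶜ)}) * (PrW D p {S | insert e S ∈ (conn a b ∩ (conn a c)ᶜ)}) + 2 * (PrW D p (conn a b ∩ conn a c)) * (PrW D p {S | insert e S ∈ ((conn a b)ᶜ ∩ ((conn a c)ᶜ ∩ (conn b c)ᶜ))}) ^ 2 - 2 * (PrW D p (conn b c ∩ (conn a b)ᶜ)) * (PrW D p {S | insert e S ∈ ((conn a b)ᶜ ∩ ((conn a c)ᶜ ∩ (conn b c)ᶜ))}) * (PrW D p {S | insert e S ∈ (conn a c ∩ (conn a b)ᶜ)}) - 2 * (PrW D p (conn b c ∩ (conn a b)ᶜ)) * (PrW D p {S | insert e S ∈ ((conn a b)ᶜ ∩ ((conn a c)ᶜ ∩ (conn b c)ᶜ))})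 * (PrW D p {S | insert e S ∈ (conn a b ∩ (conn a c)ᶜ)}) - 2 * (PrW D p (conn a c ∩ (conn a b)ᶜ)) * (PrW D p {S | insert e S ∈ ((conn a b)ᶜ ∩ ((conn a c)ᶜ ∩ (conn b c)ᶜ))}) * (PrW D p {S | insert e S ∈ (conn a b ∩ (conn a c)ᶜ)}) + (PrW D p (conn a b ∩ conn a c)) * (PrW D p {S | insert e S ∈ ((conn a b)ᶜ ∩ ((conn a c)ᶜ ∩ (conn b c)ᶜ))}) * (PrW D p {S | insert e S ∈ (conn b c ∩ (conn a b)ᶜ)}) + (PrW D p (conn a b ∩ conn a c)) * (PrW D p {S | insert e S ∈ ((conn a b)ᶜ ∩ ((conn a c)ᶜ ∩ (conn b c)ᶜ))}) * (PrW D p {S | insert e S ∈ (conn a c ∩ (conn a b)ᶜ)}) + (PrW D p (conn a b ∩ conn a c)) * (PrW D p {S | insert e S ∈ ((conn a b)ᶜ ∩ ((conn a c)ᶜ ∩ (conn b c)ᶜ))}) * (PrW D p {S | insert e S ∈ (conn a b ∩ (conn a c)ᶜ)}) + 2 * (PrW D p (conn a b ∩ conn a c)) * (PrW D p {S | insert e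 S ∈ ((conn a b)ᶜ ∩ ((conn a c)ᶜ ∩ (conn b c)ᶜ))}) * (PrW D p {S | insert e S ∈ (conn a b ∩ conn a c)}) - 2 * (PrW D p (conn a c ∩ (conn a b)ᶜ)) * (PrW D p {S | insert e S ∈ ((conn a b)ᶜ ∩ ((conn a c)ᶜ ∩ (conn b c)ᶜ))}) * (PrW D p {S | insert e S ∈ (conn b c ∩ (conn a b)ᶜ)}) - 2 * (PrW D p (conn a b ∩ (conn a c)ᶜ)) * (PrW D p {S | insert e S ∈ ((conn a b)ᶜ ∩ ((conn a c)ᶜ ∩ (conn b c)ᶜ))}) * (PrW D p {S | insert e S ∈ (conn b c ∩ (conn a b)ᶜ)}) - 2 * (PrW D p (conn a b ∩ (conn a c)ᶜ)) * (PrW D p {S | insert e S ∈ ((conn a b)ᶜ ∩ ((conn a c)ᶜ ∩ (conn b c)ᶜ))}) * (PrW D p {S | insert e S ∈ (conn a c ∩ (conn a b)ᶜ)}) + (PrW D p (conn b c ∩ (conn a b)ᶜ)) * (PrW D p {S | insert e S ∈ ((conn a b)ᶜ ∩ ((conn a c)ᶜ ∩ (conn b c)ᶜ))}) * (PrW D p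 {S | insert e S ∈ (conn a b ∩ conn a c)}) + (PrW D p (conn a c ∩ (conn a b)ᶜ)) * (PrW D p {S | insert e S ∈ ((conn a b)ᶜ ∩ ((conn a c)ᶜ ∩ (conn b c)ᶜ))}) * (PrW D p {S | insert e S ∈ (conn a b ∩ conn a c)}) + (PrW D p (conn a b ∩ (conn a c)ᶜ)) * (PrW D p {S | insert e S ∈ ((conn a b)ᶜ ∩ ((conn a c)ᶜ ∩ (conn b c)ᶜ))}) * (PrW D p {S | insert e S ∈ (conn a b ∩ conn a c)}) - (PrW D p (conn a c ∩ (conn a b)ᶜ)) * (PrW D p {S | insert e S ∈ (conn b c ∩ (conn a b)ᶜ)}) ^ 2 - (PrW D p (conn a b ∩ (conn a c)ᶜ)) * (PrW D p {S | insert e S ∈ (conn b c ∩ (conn a b)ᶜ)}) ^ 2 - 2 * (PrW D p (conn a c ∩ (conn a b)ᶜ)) * (PrW D p {S | insert e S ∈ (conn b c ∩ (conn a b)ᶜ)}) * (PrW D p {S | insert e S ∈ (conn a c ∩ (conn a b)ᶜ)}) - 4 * (PrW D p (conn a c ∩ (conn a b)ᶜ)) * (PrW D p {S | insert e S ∈ (conn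 b c ∩ (conn a b)ᶜ)}) * (PrW D p {S | insert e S ∈ (conn a b ∩ (conn a c)ᶜ)}) - 2 * (PrW D p (conn a b ∩ (conn a c)ᶜ)) * (PrW D p {S | insert e S ∈ (conn b c ∩ (conn a b)ᶜ)}) * (PrW D p {S | insert e S ∈ (conn a b ∩ (conn a c)ᶜ)}) - 4 * (PrW D p (conn a b ∩ (conn a c)ᶜ)) * (PrW D p {S | insert e S ∈ (conn b c ∩ (conn a b)ᶜ)}) * (PrW D p {S | insert e S ∈ (conn a c ∩ (conn a b)ᶜ)}) - (PrW D p (conn a b ∩ (conn a c)ᶜ)) * (PrW D p {S | insert e S ∈ (conn a c ∩ (conn a b)ᶜ)}) ^ 2 - 2 * (PrW D p (conn a b ∩ (conn a c)ᶜ)) * (PrW D p {S | insert e S ∈ (conn a c ∩ (conn a b)ᶜ)}) * (PrW D p {S | insert e S ∈ (conn a b ∩ (conn a c)ᶜ)}) - (PrW D p (conn b c ∩ (conn a b)ᶜ)) * (PrW D p {S | insert e S ∈ (conn a c ∩ (conn a b)ᶜ)}) * (PrW D p {S | insert e S ∈ (conn a b ∩ conn a c)}) - (PrW D p (conn b c ∩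 (conn a b)ᶜ)) * (PrW D p {S | insert e S ∈ (conn a b ∩ (conn a c)ᶜ)}) * (PrW D p {S | insert e S ∈ (conn a b ∩ conn a c)}) - (PrW D p (conn a c ∩ (conn a b)ᶜ)) * (PrW D p {S | insert e S ∈ (conn a b ∩ (conn a c)ᶜ)}) * (PrW D p {S | insert e S ∈ (conn a b ∩ conn a c)}) - (PrW D p (conn a c ∩ (conn a b)ᶜ)) * (PrW D p {S | insert e S ∈ (conn b c ∩ (conn a b)ᶜ)}) * (PrW D p {S | insert e S ∈ (conn a b ∩ conn a c)}) - (PrW D p (conn a b ∩ (conn a c)ᶜ)) * (PrW D p {S | insert e S ∈ (conn b c ∩ (conn a b)ᶜ)}) * (PrW D p {S | insert e S ∈ (conn a b ∩ conn a c)}) - (PrW D p (conn a b ∩ (conn a c)ᶜ)) * (PrW D p {S | insert e S ∈ (conn a c ∩ (conn a b)ᶜ)}) * (PrW D p {S | insert e S ∈ (conn a b ∩ conn a c)}) := by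
  have hp0' : ∀ i, 0 ≤ Function.update p e (1 / 2 : ℝ) i := by
    intro i
    by_cases hi : i = e
    · rw [hi, Function.update_self]; norm_num
    · rw [Function.update_of_ne hi]; exact hp0 i
  have hp1' : ∀ i, Function.update p e (1 / 2 : ℝ) i ≤ 1 := by
    intro i
    by_cases hi : i = e
    · rw [hi, Function.update_self]; norm_num
    · rw [Function.update_of_ne hi]; exact hp1 i
  have key := polar_two_nonneg hp0' hp1' (insert e D) a b c (Finset.mem_insert_self e D)
  rw [Finset.erase_insert he, Function.update_self] at key
  have hW : ∀ X : Set (Finset (Sym2 V)), PrW D (Function.update p e (1 / 2 : ℝ)) X = PrW D p X :=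
    fun X => PrW_congr_weights' D (fun i hi => Function.update_of_ne (ne_of_mem_of_not_mem hi he) _ _) X
  have h0 : ∀ E : Set (Finset (Sym2 V)), {S | ins e false S ∈ E} = E := fun E => by
    ext S; simp [ins]
  have h1 : ∀ E : Set (Finset (Sym2 V)), {S | ins e true S ∈ E} = {S | insert e S ∈ E} := fun E => by
    ext S; simp [ins]
  simp only [hW, h0, h1] at key
  exact nonneg_of_mul_nonneg_right key (by norm_num)

/-- **(TB1) in the tree's transition vocabulary.**  If the glued cells decompose through the five apex transition masses
(`q¹ = q − α₁ − α₂`, `u_c¹ = u_c + α₁ − β₁`, `u_b¹ = u_b + α₂ − β₂`, `u_a¹ = u_a − β₃`, `t¹ = t + β₁ + β₂ + β₃` — automatic when `e ∋ a`,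
prove-2's `trans_*` bookkeeping), then `0 ≤ CubicThreePointStep.threeTB₁ q u_c u_b u_a t α₁ α₂ β₁ β₂ β₃`. [this work] -/
theorem threeTB₁_nonneg_of_transitions (he : e ∉ D) {α₁ α₂ β₁ β₂ β₃ : ℝ}
    (hq : PrW D p {S | insert e S ∈ ((conn a b)ᶜ ∩ ((conn a c)ᶜ ∩ (conn b c)ᶜ))} = PrW D p ((conn a b)ᶜ ∩ ((conn a c)ᶜ ∩ (conn b c)ᶜ)) - α₁ - α₂)
    (hc : PrW D p {S | insert e S ∈ (conn a b ∩ (conn a c)ᶜ)} = PrW D p (conn a b ∩ (conn a c)ᶜ) + α₁ - β₁)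
    (hb : PrW D p {S | insert e S ∈ (conn a c ∩ (conn a b)ᶜ)} = PrW D p (conn a c ∩ (conn a b)ᶜ) + α₂ - β₂)
    (ha : PrW D p {S | insert e S ∈ (conn b c ∩ (conn a b)ᶜ)} = PrW D p (conn b c ∩ (conn a b)ᶜ) - β₃)
    (ht : PrW D p {S | insert e S ∈ (conn a b ∩ conn a c)} = PrW D p (conn a b ∩ conn a c) + β₁ + β₂ + β₃) :
    0 ≤ CubicThreePointStep.threeTB₁ (PrW D p ((conn a b)ᶜ ∩ ((conn a c)ᶜ ∩ (conn b c)ᶜ))) (PrW D p (conn a b ∩ (conn a c)ᶜ)) (PrW D p (conn a c ∩ (conn a b)ᶜ)) (PrW D p (conn b c ∩ (conn a b)ᶜ)) (PrW D p (conn a b ∩ conn a c)) α₁ α₂ β₁ β₂ β₃ := by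
  have key := tincPolar12_nonneg hp0 hp1 D a b c he
  rw [hq, hc, hb, ha, ht] at key
  rw [threeTB₁_eq_polar]
  exact key

/-- **(TB2) in the tree's transition vocabulary** (same hypotheses). [this work] -/
theorem threeTB₂_nonneg_of_transitions (he : e ∉ D) {α₁ α₂ β₁ β₂ β₃ : ℝ}
    (hq : PrW D p {S | insert e S ∈ ((conn a b)ᶜ ∩ ((conn a c)ᶜ ∩ (conn b c)ᶜ))} = PrW D p ((conn a b)ᶜ ∩ ((conn a c)ᶜ ∩ (conn b c)ᶜ)) - α₁ - α₂)
    (hc : PrW D p {S | insert e S ∈ (conn a b ∩ (conn a c)ᶜ)} = PrW D p (conn a b ∩ (conn a c)ᶜ) + α₁ - β₁)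
    (hb : PrW D p {S | insert e S ∈ (conn a c ∩ (conn a b)ᶜ)} = PrW D p (conn a c ∩ (conn a b)ᶜ) + α₂ - β₂)
    (ha : PrW D p {S | insert e S ∈ (conn b c ∩ (conn a b)ᶜ)} = PrW D p (conn b c ∩ (conn a b)ᶜ) - β₃)
    (ht : PrW D p {S | insert e S ∈ (conn a b ∩ conn a c)} = PrW D p (conn a b ∩ conn a c) + β₁ + β₂ + β₃) :
    0 ≤ CubicThreePointStep.threeTB₂ (PrW D p ((conn a b)ᶜ ∩ ((conn a c)ᶜ ∩ (conn b c)ᶜ))) (PrW D p (conn a b ∩ (conn a c)ᶜ)) (PrW D p (conn a c ∩ (conn a b)ᶜ)) (PrW D p (conn b c ∩ (conn a b)ᶜ)) (PrW D p (conn a b ∩ conn a c)) α₁ α₂ β₁ β₂ β₃ := by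
  have key := tincPolar21_nonneg hp0 hp1 D a b c he
  rw [hq, hc, hb, ha, ht] at key
  rw [threeTB₂_eq_polar]
  exact key

end Pencil

end TIncFibre

end Summit.CriticalPhenomena.PercolationContinuityZ3.Theorems

end
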